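import Summits.BirchSwinnertonDyer.Rank1Residual.GaloisImage.ThreeTorsionPairValues
import Literature.NumberTheory.EllipticCurves.GaloisActionProofs
import Literature.NumberTheory.GaloisRepresentations.AbsGaloisGroup
import HarnessLib

/-!
# The cube-root Weil pairing on `E[3]`
# (cell `b2b-bsdres`, team n1011, seat p02 gen 10 — row T-E3SYMP, file F2; TOOL)

HONEST FRAMING (cell `b2b-bsdres`, run/shared/lean/b2b/bsd-rank1-residual/, verbatim in every
file): the goal of the cell is to DELETE the COMBINATION-SHAPED residual classes of the
Birch–Swinnerton-Dyer formula for ALL analytic-rank `≤ 1` elliptic curves over `ℚ` — "full BSD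
formula for every rank `≤ 1` curve in class `C`" assembled STRICTLY from published theorems — so
that the rank-`≤ 1` remainder becomes exactly the CONSTRUCTION-SHAPED classes, which are TYPED
(missing-input `Prop`s), NOT attempted. This is not "finishing BSD". Team n1011 (N10 / N11):
research route; no claim beyond the stated classes; labels UNCHANGED; nothing is booked. Theorems
only (no definition, no named fact).

## What this file proves

With the pair values `B₁ = b₄ − 3(x_S x_T + x_{S+T} x_{S−T})`, `B₂ = b₄ − 3(x_S x_{S+T} + x_T x_{S−T})`,
`B₃ = b₄ − 3(x_S x_{S−T} + x_T x_{S+T})` of file F1 (the three cube roots of `Δ` on a basis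
`S, T` of the `3`-torsion), the CUBE-ROOT PAIRING is

  `e(S, T) := B₂/B₁` if `S, T, S + T, S − T ≠ O`, and `:= 1` otherwise.

* §1 `eq_of_basis_of_three_smul` — EXHAUSTION: every point killed by `3` is one of
  `O, ±S, ±T, ±(S+T), ±(S−T)` (its abscissa is a root of `Ψ₃ = 3∏(X − ·)`; no counting needed).
* §2–3: for any function `e` satisfying the displayed formula (`he`), on points killed by `3`:
  `e S T ^ 3 = 1`, `e T T = 1`, `e T S = (e S T)⁻¹`, `e (S + T) T = e S T`, `e (−S) T = (e S T)⁻¹`,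
  BILINEARITY `e (S₁ + S₂) T = e S₁ T · e S₂ T`, `e S (T₁ + T₂) = e S T₁ · e S T₂`, and
  `e S T ≠ 1` on a basis (the relabelled bases `(T,S)`, `(S+T,T)`, `(−S,T)` have pair values
  `(B₁,B₃)`, `(B₃,B₁)`, `(B₁,B₃)` in place of `(B₁,B₂)`, and `B₁² = B₂B₃`; then the nine points).
* §4 `exists_cubeRootWeilPairing` — for an elliptic curve `W/K` (`char K = 0`) there is
  `e : E[3] → E[3] → K̄` which is `μ₃`-valued, bilinear, alternating, NON-DEGENERATE and
  `Γ_K`-EQUIVARIANT — i.e. the body of the tree's existential `WeierstrassCurve.exists_weilPairing W 3`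
  (Silverman *AEC* III.8.1 (a)–(d)) VERBATIM — AND satisfies the closed formula `e S T · B₁ = B₂` on
  every basis (so a record can COMPUTE it).  Non-degeneracy uses `#E[3] = 9` (tree
  `card_torsionPoints_eq_sq_holds`); equivariance holds because `σ` acts on abscissae.

Not claimed: that the divisor-theoretic witness of `exists_weilPairing_holds` equals this `e` (or
its inverse); every tree consumer (`KummerImageIsotropy`, `WeilPairingTateDual`, T-K43 F3,
T-K43-COH) is parametric in `e`.  File F3 proves the Δ-CUBE LAW of `3`-congruences for pairings
normalised by this formula.  References (context): Silverman *AEC* III.8; Serre 1972 §5.3.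
-/

noncomputable section

open scoped Classical

open Polynomial WeierstrassCurve WeierstrassCurve.Affine.Point Literature.NumberTheory.EllipticCurves

namespace Summit.BirchSwinnertonDyer.Rank1Residual.GaloisImage.CubeRootPairing

universe u

/-! ### §0. Two more facts about elements killed by `3` -/

section Group

variable {G : Type*} [AddCommGroup G]

/-- `3(−P) = 0` when `3P = 0`. [folklore] -/
theorem three_smul_neg {P : G} (h : (3 : ℤ) • P = 0) : (3 : ℤ) • (-P) = 0 := by
  rw [zsmul_neg, h, _root_.neg_zero]

/-- `S + T + T = S − T` when `3T = 0`. [folklore] -/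
theorem add_add_eq_sub_of_three_smul {S T : G} (hT : (3 : ℤ) • T = 0) : S + T + T = S - T := by
  rw [add_assoc, add_self_eq_neg_of_three_smul hT, sub_eq_add_neg]

end Group

/-! ### §1. Exhaustion of `E[3]` by a basis -/

section Exhaust

variable {F : Type u} [Field F] [CharZero F] {W : WeierstrassCurve F} [W.IsElliptic]

/-- **Every point killed by `3` is one of the nine points of a basis**: for `3S = 3T = 0` with
`S, T, S + T, S − T ≠ O` and `3P = 0`, `P ∈ {O, ±S, ±T, ±(S + T), ±(S − T)}` (the abscissa of
`P ≠ O` is a root of `Ψ₃ = 3(X − x_S)(X − x_T)(X − x_{S+T})(X − x_{S−T})`).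
[cite: SilvermanAEC2009, Exercise 3.7 (d) and Cor. III.6.4] -/
theorem eq_of_basis_of_three_smul {S T : W.toAffine.Point} (hS : (3 : ℤ) • S = 0)
    (hT : (3 : ℤ) • T = 0) (h₁ : S ≠ 0) (h₂ : T ≠ 0) (h₃ : S + T ≠ 0) (h₄ : S - T ≠ 0)
    {P : W.toAffine.Point} (hP : (3 : ℤ) • P = 0) :
    P = 0 ∨ P = S ∨ P = -S ∨ P = T ∨ P = -T ∨ P = S + T ∨ P = -(S + T) ∨
      P = S - T ∨ P = -(S - T) := by
  by_cases hP0 : P = 0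
  · exact Or.inl hP0
  right
  have hx := eval_Ψ₃_xOf_eq_zero W hP hP0
  rw [Ψ₃_eq_prod_of_basis hS hT h₁ h₂ h₃ h₄] at hx
  simp only [eval_mul, eval_sub, eval_X, eval_C, mul_eq_zero, sub_eq_zero] at hx
  rcases hx with h3 | ha | hb | hc | hd
  · norm_num at h3
  · rcases eq_or_eq_neg_of_xOf_eq W h₁ hP0 ha.symm with h | h
    · exact Or.inl h
    · exact Or.inr (Or.inl h)
  · rcases eq_or_eq_neg_of_xOf_eq W h₂ hP0 hb.symm with h | h
    · exact Or.inr (Or.inr (Or.inl h))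
    · exact Or.inr (Or.inr (Or.inr (Or.inl h)))
  · rcases eq_or_eq_neg_of_xOf_eq W h₃ hP0 hc.symm with h | h
    · exact Or.inr (Or.inr (Or.inr (Or.inr (Or.inl h))))
    · exact Or.inr (Or.inr (Or.inr (Or.inr (Or.inr (Or.inl h)))))
  · rcases eq_or_eq_neg_of_xOf_eq W h₄ hP0 hd.symm with h | h
    · exact Or.inr (Or.inr (Or.inr (Or.inr (Or.inr (Or.inr (Or.inl h))))))
    · exact Or.inr (Or.inr (Or.inr (Or.inr (Or.inr (Or.inr (Or.inr h))))))

end Exhaust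

/-! ### §2. Relabelled bases -/

section Relabel

variable {F : Type u} [Field F] {W : WeierstrassCurve F}

/-- The basis `(T, S)`: pair values `(B₁, B₃)` of `(S, T)`. [folklore] -/
theorem pairValues_swap (S T : W.toAffine.Point) :
    W.b₄ - 3 * (xOf T * xOf S + xOf (T + S) * xOf (T - S)) =
      W.b₄ - 3 * (xOf S * xOf T + xOf (S + T) * xOf (S - T)) ∧
    W.b₄ - 3 * (xOf T * xOf (T + S) + xOf S * xOf (T - S)) =
      W.b₄ - 3 * (xOf S * xOf (S - T) + xOf T * xOf (S + T)) := by
  rw [add_comm T S, ← neg_sub S T, xOf_neg]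
  constructor <;> ring

/-- The basis `(S + T, T)` (`3T = 0`): pair values `(B₃, B₁)` of `(S, T)`. [folklore] -/
theorem pairValues_shift {S T : W.toAffine.Point} (hT : (3 : ℤ) • T = 0) :
    W.b₄ - 3 * (xOf (S + T) * xOf T + xOf (S + T + T) * xOf (S + T - T)) =
      W.b₄ - 3 * (xOf S * xOf (S - T) + xOf T * xOf (S + T)) ∧
    W.b₄ - 3 * (xOf (S + T) * xOf (S + T + T) + xOf T * xOf (S + T - T)) =
      W.b₄ - 3 * (xOf S * xOf T + xOf (S + T) * xOf (S - T)) := by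
  rw [add_add_eq_sub_of_three_smul hT, add_sub_cancel_right]
  constructor <;> ring

/-- The basis `(−S, T)`: pair values `(B₁, B₃)` of `(S, T)`. [folklore] -/
theorem pairValues_negLeft (S T : W.toAffine.Point) :
    W.b₄ - 3 * (xOf (-S) * xOf T + xOf (-S + T) * xOf (-S - T)) =
      W.b₄ - 3 * (xOf S * xOf T + xOf (S + T) * xOf (S - T)) ∧
    W.b₄ - 3 * (xOf (-S) * xOf (-S + T) + xOf T * xOf (-S - T)) =
      W.b₄ - 3 * (xOf S * xOf (S - T) + xOf T * xOf (S + T)) := by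
  have h1 : -S + T = -(S - T) := by abel
  have h2 : -S - T = -(S + T) := by abel
  rw [h1, h2, xOf_neg, xOf_neg, xOf_neg]
  exact ⟨by ring, by ring⟩

end Relabel

/-! ### §3. The pairing axioms from the formula -/

section Formula

variable {F : Type u} [Field F] [CharZero F] {W : WeierstrassCurve F} [W.IsElliptic]
variable {e : W.toAffine.Point → W.toAffine.Point → F}
  (he : ∀ S T, e S T = if S ≠ 0 ∧ T ≠ 0 ∧ S + T ≠ 0 ∧ S - T ≠ 0 then
    (W.b₄ - 3 * (xOf S * xOf (S + T) + xOf T * xOf (S - T))) /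
      (W.b₄ - 3 * (xOf S * xOf T + xOf (S + T) * xOf (S - T))) else 1)
include he

/-- On a basis the formula's value `ω = B₂/B₁` satisfies `ω³ = 1`, `ω ≠ 1`, `ω ≠ 0`,
`ω² = ω⁻¹` and `B₃/B₁ = ω⁻¹`. [folklore] -/
theorem formula_basis {S T : W.toAffine.Point} (hS : (3 : ℤ) • S = 0) (hT : (3 : ℤ) • T = 0)
    (h₁ : S ≠ 0) (h₂ : T ≠ 0) (h₃ : S + T ≠ 0) (h₄ : S - T ≠ 0) :
    e S T ^ 3 = 1 ∧ e S T ≠ 1 ∧ e S T ≠ 0 ∧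
      (W.b₄ - 3 * (xOf S * xOf (S - T) + xOf T * xOf (S + T))) /
        (W.b₄ - 3 * (xOf S * xOf T + xOf (S + T) * xOf (S - T))) = (e S T)⁻¹ ∧
      (W.b₄ - 3 * (xOf S * xOf T + xOf (S + T) * xOf (S - T))) /
        (W.b₄ - 3 * (xOf S * xOf (S - T) + xOf T * xOf (S + T))) = e S T := by
  obtain ⟨hB₁, -, hB₃, -, -, -, s1, -, -, -, -, -, -, w2, w3, w4⟩ :=
    cubeRoots_of_sum_eq_zero (pairValues_sum_eq_zero hS hT h₁ h₂ h₃ h₄)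
      (pairValues_sum_mul_eq_zero hS hT h₁ h₂ h₃ h₄) (pairValues_prod_eq_Δ hS hT h₁ h₂ h₃ h₄)
      W.isUnit_Δ.ne_zero
  have hω : e S T = (W.b₄ - 3 * (xOf S * xOf (S + T) + xOf T * xOf (S - T))) /
      (W.b₄ - 3 * (xOf S * xOf T + xOf (S + T) * xOf (S - T))) := by
    rw [he, if_pos ⟨h₁, h₂, h₃, h₄⟩]
  rw [hω]
  have hω0 : (W.b₄ - 3 * (xOf S * xOf (S + T) + xOf T * xOf (S - T))) /
      (W.b₄ - 3 * (xOf S * xOf T + xOf (S + T) * xOf (S - T))) ≠ 0 := by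
    intro h0; rw [h0] at w2; norm_num at w2
  refine ⟨w2, w3, hω0, ?_, ?_⟩
  · rw [w4]
    exact eq_inv_of_mul_eq_one_left (by rw [← pow_succ, w2])
  · rw [div_eq_iff hB₃, div_mul_eq_mul_div, eq_div_iff hB₁]
    linear_combination s1

omit [CharZero F] [W.IsElliptic] in
/-- `e S T = 1` off bases (one of `S, T, S + T, S − T` is `O`). [folklore] -/
theorem formula_eq_one {S T : W.toAffine.Point} (h : ¬(S ≠ 0 ∧ T ≠ 0 ∧ S + T ≠ 0 ∧ S - T ≠ 0)) :
    e S T = 1 := by rw [he, if_neg h]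

/-- **(a) `e S T ^ 3 = 1`.** [cite: SilvermanAEC2009, Prop. III.8.1] -/
theorem formula_pow_three {S T : W.toAffine.Point} (hS : (3 : ℤ) • S = 0) (hT : (3 : ℤ) • T = 0) :
    e S T ^ 3 = 1 := by
  by_cases h : S ≠ 0 ∧ T ≠ 0 ∧ S + T ≠ 0 ∧ S - T ≠ 0
  · exact (formula_basis he hS hT h.1 h.2.1 h.2.2.1 h.2.2.2).1
  · rw [formula_eq_one he h, one_pow]

omit [CharZero F] [W.IsElliptic] in
/-- **(b) alternating: `e T T = 1`.** [cite: SilvermanAEC2009, Prop. III.8.1 (b)] -/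
theorem formula_self (T : W.toAffine.Point) : e T T = 1 :=
  formula_eq_one he fun h => h.2.2.2 (sub_self T)

/-- **Antisymmetry: `e T S = (e S T)⁻¹`.** [cite: SilvermanAEC2009, Prop. III.8.1] -/
theorem formula_swap {S T : W.toAffine.Point} (hS : (3 : ℤ) • S = 0) (hT : (3 : ℤ) • T = 0) :
    e T S = (e S T)⁻¹ := by
  by_cases h : S ≠ 0 ∧ T ≠ 0 ∧ S + T ≠ 0 ∧ S - T ≠ 0
  · obtain ⟨h₁, h₂, h₃, h₄⟩ := h
    have h' : T ≠ 0 ∧ S ≠ 0 ∧ T + S ≠ 0 ∧ T - S ≠ 0 :=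
      ⟨h₂, h₁, by rwa [add_comm], by rw [← neg_sub, neg_ne_zero]; exact h₄⟩
    obtain ⟨e1, e2⟩ := pairValues_swap S T
    rw [he T S, if_pos h', e1, e2]
    exact (formula_basis he hS hT h₁ h₂ h₃ h₄).2.2.2.1
  · have h' : ¬(T ≠ 0 ∧ S ≠ 0 ∧ T + S ≠ 0 ∧ T - S ≠ 0) := by
      rintro ⟨h₂, h₁, h₃, h₄⟩
      exact h ⟨h₁, h₂, by rwa [add_comm], by rw [← neg_sub, neg_ne_zero]; exact h₄⟩
    rw [formula_eq_one he h, formula_eq_one he h', inv_one]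

/-- **Translation: `e (S + T) T = e S T`.** [folklore] -/
theorem formula_add_right_self {S T : W.toAffine.Point} (hS : (3 : ℤ) • S = 0)
    (hT : (3 : ℤ) • T = 0) : e (S + T) T = e S T := by
  by_cases h : S ≠ 0 ∧ T ≠ 0 ∧ S + T ≠ 0 ∧ S - T ≠ 0
  · obtain ⟨h₁, h₂, h₃, h₄⟩ := h
    have h' : S + T ≠ 0 ∧ T ≠ 0 ∧ S + T + T ≠ 0 ∧ S + T - T ≠ 0 :=
      ⟨h₃, h₂, by rw [add_add_eq_sub_of_three_smul hT]; exact h₄, by rwa [add_sub_cancel_right]⟩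
    obtain ⟨e1, e2⟩ := pairValues_shift (S := S) hT
    rw [he (S + T) T, if_pos h', e1, e2]
    exact (formula_basis he hS hT h₁ h₂ h₃ h₄).2.2.2.2
  · rw [formula_eq_one he h]
    apply formula_eq_one he
    rintro ⟨h₃, h₂, h₅, h₆⟩
    rw [add_sub_cancel_right] at h₆
    rw [add_add_eq_sub_of_three_smul hT] at h₅
    exact h ⟨h₆, h₂, h₃, h₅⟩

/-- **Negation: `e (−S) T = (e S T)⁻¹`.** [folklore] -/
theorem formula_neg_left {S T : W.toAffine.Point} (hS : (3 : ℤ) • S = 0) (hT : (3 : ℤ) • T = 0) :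
    e (-S) T = (e S T)⁻¹ := by
  by_cases h : S ≠ 0 ∧ T ≠ 0 ∧ S + T ≠ 0 ∧ S - T ≠ 0
  · obtain ⟨h₁, h₂, h₃, h₄⟩ := h
    have h' : -S ≠ 0 ∧ T ≠ 0 ∧ -S + T ≠ 0 ∧ -S - T ≠ 0 :=
      ⟨neg_ne_zero.mpr h₁, h₂, by rw [show -S + T = -(S - T) by abel, neg_ne_zero]; exact h₄,
        by rw [show -S - T = -(S + T) by abel, neg_ne_zero]; exact h₃⟩
    obtain ⟨e1, e2⟩ := pairValues_negLeft S T
    rw [he (-S) T, if_pos h', e1, e2]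
    exact (formula_basis he hS hT h₁ h₂ h₃ h₄).2.2.2.1
  · have h' : ¬(-S ≠ 0 ∧ T ≠ 0 ∧ -S + T ≠ 0 ∧ -S - T ≠ 0) := by
      rintro ⟨h₁, h₂, h₃, h₄⟩
      refine h ⟨neg_ne_zero.mp h₁, h₂, ?_, ?_⟩
      · rw [show -S - T = -(S + T) by abel, neg_ne_zero] at h₄; exact h₄
      · rw [show -S + T = -(S - T) by abel, neg_ne_zero] at h₃; exact h₃
    rw [formula_eq_one he h, formula_eq_one he h', inv_one]

/-- `e (S − T) T = e S T`. [folklore] -/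
theorem formula_sub_right_self {S T : W.toAffine.Point} (hS : (3 : ℤ) • S = 0)
    (hT : (3 : ℤ) • T = 0) : e (S - T) T = e S T := by
  have := formula_add_right_self he (three_smul_sub hS hT) hT
  rw [sub_add_cancel] at this
  exact this.symm

omit [CharZero F] [W.IsElliptic] in
/-- `e O T = 1`. [folklore] -/
theorem formula_zero_left (T : W.toAffine.Point) : e 0 T = 1 :=
  formula_eq_one he fun h => h.1 rfl

/-- **(a) bilinearity in the first variable: `e (S₁ + S₂) T = e S₁ T · e S₂ T`** on points killed
by `3`. [cite: SilvermanAEC2009, Prop. III.8.1 (a)] -/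
theorem formula_add_left {S₁ S₂ T : W.toAffine.Point} (hS₁ : (3 : ℤ) • S₁ = 0)
    (hS₂ : (3 : ℤ) • S₂ = 0) (hT : (3 : ℤ) • T = 0) :
    e (S₁ + S₂) T = e S₁ T * e S₂ T := by
  by_cases hT0 : T = 0
  · subst hT0
    rw [formula_eq_one he fun h => h.2.1 rfl, formula_eq_one he fun h => h.2.1 rfl,
      formula_eq_one he fun h => h.2.1 rfl, one_mul]
  by_cases h : S₁ ≠ 0 ∧ T ≠ 0 ∧ S₁ + T ≠ 0 ∧ S₁ - T ≠ 0
  · obtain ⟨h₁, h₂, h₃, h₄⟩ := h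
    obtain ⟨w3, -, hω0, -, -⟩ := formula_basis he hS₁ hT h₁ h₂ h₃ h₄
    have hsq : e S₁ T * e S₁ T = (e S₁ T)⁻¹ :=
      eq_inv_of_mul_eq_one_left (by rw [← pow_two, ← pow_succ, w3])
    have hSS := add_self_eq_neg_of_three_smul hS₁
    rcases eq_of_basis_of_three_smul hS₁ hT h₁ h₂ h₃ h₄ hS₂ with
      rfl | rfl | rfl | rfl | rfl | rfl | rfl | rfl | rfl
    · rw [add_zero, formula_zero_left he, mul_one]
    · rw [hSS, formula_neg_left he hS₁ hT, hsq]
    · rw [add_neg_cancel, formula_zero_left he, formula_neg_left he hS₁ hT, mul_inv_cancel₀ hω0]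
    · rw [formula_add_right_self he hS₁ hT, formula_self he, mul_one]
    · rw [← sub_eq_add_neg, formula_sub_right_self he hS₁ hT, formula_neg_left he hT hT,
        formula_self he, inv_one, mul_one]
    · rw [← add_assoc, hSS, formula_add_right_self he (three_smul_neg hS₁) hT,
        formula_add_right_self he hS₁ hT, formula_neg_left he hS₁ hT, hsq]
    · rw [show S₁ + -(S₁ + T) = -T by abel, formula_neg_left he hT hT, formula_self he, inv_one,
        formula_neg_left he (three_smul_add hS₁ hT) hT, formula_add_right_self he hS₁ hT,
        mul_inv_cancel₀ hω0]
    · rw [show S₁ + (S₁ - T) = S₁ + S₁ - T by abel, hSS, show -S₁ - T = -(S₁ + T) by abel,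
        formula_neg_left he (three_smul_add hS₁ hT) hT, formula_add_right_self he hS₁ hT,
        formula_sub_right_self he hS₁ hT, hsq]
    · rw [show S₁ + -(S₁ - T) = T by abel, formula_self he,
        formula_neg_left he (three_smul_sub hS₁ hT) hT, formula_sub_right_self he hS₁ hT,
        mul_inv_cancel₀ hω0]
  · -- `S₁ ∈ {O, −T, T}`
    have hcases : S₁ = 0 ∨ S₁ = -T ∨ S₁ = T := by
      by_contra hc
      push Not at hc
      exact h ⟨hc.1, hT0, fun h0 => hc.2.1 (eq_neg_of_add_eq_zero_left h0),
        fun h0 => hc.2.2 (sub_eq_zero.mp h0)⟩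
    rw [formula_eq_one he h, one_mul]
    rcases hcases with rfl | rfl | rfl
    · rw [zero_add]
    · rw [neg_add_eq_sub, formula_sub_right_self he hS₂ hT]
    · rw [add_comm, formula_add_right_self he hS₂ hT]

end Formula

end Summit.BirchSwinnertonDyer.Rank1Residual.GaloisImage.CubeRootPairing

end
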